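import Literature.AlgebraicGeometry.Frobenioids.Thm36Sub
import Literature.AlgebraicGeometry.Frobenioids.PerfectionEndomorphisms
import Literature.AlgebraicGeometry.Frobenioids.PerfectionIsos
import Literature.AlgebraicGeometry.Frobenioids.ArchimedeanAutActionFactors
import HarnessLib

/-!
# Frobenioids II, Theorem 3.6 (iv), first sentence, for `C^ℚ := C^pf` — PROVED (slot `Thm36Sub.ivFactors_Q`)

Mochizuki, *The geometry of Frobenioids II: poly-Frobenioids*, Kyushu J. Math. **62** (2008) 401–460, §3,
Theorem 3.6 (iv), first sentence, author's kurims text p. 37 [cite: MochizukiFrdII2008, Thm 3.6 (iv) p.37]: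

> "(iv) Let `A ∈ Ob(F)`; `A_D := Base(A) ∈ Ob(D)`. Write `A₀ ∈ Ob(D₀)` for the image of `A_D` in `D₀`.
> Then the natural action of `Aut_F(A)` on `O^▷(A), O^×(A)` factors through `Aut_{D₀}(A₀)`."

for `F = C^ℚ = C^pf`, THE perfection of the archimedean Frobenioid `C` of Example 3.3 ([FrdII] Ex. 3.3 (ii)
p. 28: "`C^ℚ := C^pf`"; [FrdI] Def. 3.1 (iii)).  PROOF-ONLY companion (no definitions) of the sub-DAG
statements file `Thm36Sub.lean` (seat abc-iut-w4-d074, row M13 of plan/L1/SUBDAG-FrdII-Thm36-Prop35.md): it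
CLOSES the slot `ArchFrd.Thm36Sub.ivFactors_Q` ("SLOT: as `thm36iv_factors_C`").  Node FrdII:Thm3.6(iv) of
the abc-iut cell (layer L1); seat abc-iut-w5-d190.

Argument (print, p. 39: "follow[s] immediately from the definitions"; here: reduction to the `Λ = ℤ` case
`ArchFrd.thm36iv_factors_C` of `ArchimedeanAutActionFactors.lean` along the inductive-limit description of the
endomorphisms of an object `(A, n)` of `C^pf`, [FrdI] Def. 3.1 (ii)/(iii), seat abc-iut-L1-d9):
* an automorphism `α` of `X = (A, n)` in `C^pf` is the class `[θ]` of an ISOMORPHISM `θ` of some Frobenius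
  power `A^{(c)}` of `C` ([FrdI] Prop. 3.2 (ii), `Perfection.exists_isIso_lift_of_isIso`), and then
  `α⁻¹ = [θ⁻¹]` (`exists_isIso_endClass_eq`, `inv_eq_endClass_inv`);
* an element `f ∈ O^▷(X)` is the class `[φ]` of some `φ ∈ O^▷(A^{(c)})` ([FrdI] Prop. 5.5 (i),
  `Perfection.exists_endClassHom_eq_of_mem`); all three representatives may be taken at ONE common level
  (transport `liftLevel` changes neither classes, nor invertibility, nor membership in `O^▷`);
* `Base([θ]) = Base(frob_c) ≫ Base(θ) ≫ Base(frob_c)⁻¹` (`Perfection.Rep.baseMap`), so automorphisms of `X`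
  with the same image in `Aut_{D₀}(X₀)` have representatives `θ, θ'` with the same image in
  `Aut_{D₀}((A^{(c)})₀)` (`map_base_eq_of_map_endClass_eq`; one common level: `exists_common_reps`), and `thm36iv_factors_C` at the object `A^{(c)}` of `C`
  gives `θ⁻¹ ≫ φ ≫ θ = θ'⁻¹ ≫ φ ≫ θ'`, whence `α⁻¹ ≫ f ≫ α = α'⁻¹ ≫ f ≫ α'` since classes at one level compose
  in `C` (`Perfection.endClass_comp`); the `O^×` clause follows from the `O^▷` clause (`O^× ⊆ O^▷`).
No statement of the paper is strengthened; nothing here takes a side on [IUTchIII] Cor. 3.12 ([FrdII] §3 is a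
refereed preparatory paper).
-/

noncomputable section

namespace Literature.AlgebraicGeometry.Frobenioids

open CategoryTheory

universe w v v' u u'

/-! ### Generic bookkeeping in the perfection `C^pf` of a Frobenioid ([FrdI] Def. 3.1 (iii)) -/

namespace PreFrobenioid

namespace Perfection

variable {D : Type u} [Category.{v} D] {Φ : Dᵒᵖ ⥤ CommMonCat.{w}}
  {C : Type u'} [Category.{v'} C] {F : C ⥤ ElemFrobenioid Φ} {hF : IsFrobenioid F}
  (X : Perfection hF)

/-- The transport of an endomorphism `θ` of `A^{(c)}` to the multiple level `c'` (`c ∣ c'`): the Prop. 1.10 (i)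
conjugate along the transition arrow `A^{(c)} → A^{(c')}`, read at the diagonal levels of `X = (A, n)`.
[cite: MochizukiFrdI2008, Def. 3.1 (ii) p.56] -/
theorem endClass_lift_diag {c c' : ℕ+} (h : c ∣ c') (θ : frobPow hF X.obj c ⟶ frobPow hF X.obj c) :
    endClass X c' (Level.lift (Level.diag X c) (Level.diag X c') ⟨h, h⟩ θ) = endClass X c θ :=
  Hom.mk_lift ⟨Level.diag X c, θ⟩ (Level.diag X c') ⟨h, h⟩

/-- Transport to a multiple diagonal level preserves membership in `O^▷` ([FrdI] Prop. 1.10 (i)).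
[cite: MochizukiFrdI2008, Prop. 1.10 (i) p.34] -/
theorem lift_diag_mem {c c' : ℕ+} (h : c ∣ c') (θ : frobPow hF X.obj c ⟶ frobPow hF X.obj c)
    (hθ : End.of θ ∈ endSubmonoid F (frobPow hF X.obj c)) :
    End.of (Level.lift (Level.diag X c) (Level.diag X c') ⟨h, h⟩ θ) ∈ endSubmonoid F (frobPow hF X.obj c') :=
  (liftLevel_mem_iff X h (End.of θ) _).mpr hθ

/-- **An automorphism of `(A, n)` in `C^pf` is the class of an ISOMORPHISM of some `A^{(c)}`** ([FrdI] Prop. 3.2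
(ii): a perfected morphism is an isomorphism iff a cofinal family of its representatives consists of
isomorphisms). [cite: MochizukiFrdI2008, Prop. 3.2 (ii) p.59] -/
theorem exists_isIso_endClass_eq (f : X ⟶ X) [IsIso f] :
    ∃ (c : ℕ+) (θ : frobPow hF X.obj c ⟶ frobPow hF X.obj c), IsIso θ ∧ endClass X c θ = f := by
  obtain ⟨c₀, θ₀, e₀⟩ := exists_endClass_eq X f
  have hiso : IsIso (X := X) (Y := X) (Hom.mk ⟨Level.diag X c₀, θ₀⟩) := by
    rw [← endClass_def, e₀]; infer_instance
  obtain ⟨⟨a, b, hab⟩, hN, hI⟩ := exists_isIso_lift_of_isIso ⟨Level.diag X c₀, θ₀⟩ hiso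
  obtain rfl : a = b := mul_left_cancel hab
  refine ⟨a, Level.lift (Level.diag X c₀) ⟨a, a, hab⟩ hN θ₀, hI, ?_⟩
  rw [← e₀]
  exact Hom.mk_lift ⟨Level.diag X c₀, θ₀⟩ ⟨a, a, hab⟩ hN

/-- If `α = [θ]` with `θ` an isomorphism of `A^{(c)}`, then `α⁻¹ = [θ⁻¹]` (classes at one level compose in
`C`). [cite: MochizukiFrdI2008, Def. 3.1 (iii) p.57] -/
theorem inv_eq_endClass_inv (α : X ≅ X) {c : ℕ+} (θ : frobPow hF X.obj c ⟶ frobPow hF X.obj c) [IsIso θ]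
    (hθ : endClass X c θ = α.hom) : α.inv = endClass X c (inv θ) := by
  apply Iso.inv_ext
  rw [← hθ, endClass_comp, IsIso.hom_inv_id, endClass_id]

/-- `Base([θ]) = Base(frob_c) ≫ Base(θ) ≫ Base(frob_c)⁻¹` for the base functor of the structure
`C^pf → F_{Φ^pf}` of Prop. 3.2 (i), after any functor `G` out of the base category.
[cite: MochizukiFrdI2008, Prop. 3.2 (i) p.58] -/
theorem map_baseFunctor_map_endClass {E : Type*} [Category E] (G : D ⥤ E) (c : ℕ+)
    (θ : frobPow hF X.obj c ⟶ frobPow hF X.obj c) :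
    (PreFrobenioid.baseFunctor (ops hF).toFunctor ⋙ G).map (endClass X c θ) =
      G.map (Base F (frob hF X.obj c)) ≫ G.map (Base F θ) ≫ G.map (baseInvFrob hF X.obj c) := by
  rw [← G.map_comp, ← G.map_comp]
  rfl

/-- Automorphism representatives inherit "same image in the base": if `[θ]`, `[θ']` (one level `c`) have the
same image under a functor `G` out of the base category, then so do `θ`, `θ'` (conjugation by the image of the
base-isomorphism `Base(frob_c)` is injective). [cite: MochizukiFrdI2008, Prop. 3.2 (i) p.58] -/
theorem map_base_eq_of_map_endClass_eq {E : Type*} [Category E] (G : D ⥤ E) (c : ℕ+)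
    (θ θ' : frobPow hF X.obj c ⟶ frobPow hF X.obj c)
    (h : (PreFrobenioid.baseFunctor (ops hF).toFunctor ⋙ G).map (endClass X c θ) =
      (PreFrobenioid.baseFunctor (ops hF).toFunctor ⋙ G).map (endClass X c θ')) :
    G.map (Base F θ) = G.map (Base F θ') := by
  rw [map_baseFunctor_map_endClass, map_baseFunctor_map_endClass] at h
  haveI := isIso_base_frob hF X.obj c
  haveI : IsIso (baseInvFrob hF X.obj c) :=
    ⟨⟨Base F (frob hF X.obj c), baseInvFrob_base_frob hF X.obj c, base_frob_baseInvFrob hF X.obj c⟩⟩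
  have h' := (cancel_epi (G.map (Base F (frob hF X.obj c)))).mp h
  exact (cancel_mono (G.map (baseInvFrob hF X.obj c))).mp h'

/-- **Common representatives.** Two automorphisms `α, α'` of `X = (A, n)` and an element `f ∈ O^▷(X)` are the
classes, at ONE diagonal level `c`, of isomorphisms `Θ, Θ'` of `A^{(c)}` and of an element `Ψ ∈ O^▷(A^{(c)})`
(levels are directed; transport changes neither classes, nor invertibility, nor membership in `O^▷`).
[cite: MochizukiFrdI2008, Def. 3.1 (iii) p.57] -/
theorem exists_common_reps (α α' : X ≅ X) {f : End X} (hf : f ∈ (ops hF).endSubmonoid X) :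
    ∃ (c : ℕ+) (Θ Θ' Ψ : frobPow hF X.obj c ⟶ frobPow hF X.obj c), IsIso Θ ∧ IsIso Θ' ∧
      endClass X c Θ = α.hom ∧ endClass X c Θ' = α'.hom ∧ endClass X c Ψ = f ∧
        End.of Ψ ∈ endSubmonoid F (frobPow hF X.obj c) := by
  obtain ⟨c₁, θ₁, hθ₁, e₁⟩ := exists_isIso_endClass_eq X α.hom
  obtain ⟨c₂, θ₂, hθ₂, e₂⟩ := exists_isIso_endClass_eq X α'.hom
  obtain ⟨c₃, φ, hφ, e₃⟩ := exists_endClassHom_eq_of_mem X hf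
  have h₁ : c₁ ∣ c₁ * c₂ * c₃ := Dvd.intro (c₂ * c₃) (mul_assoc _ _ _).symm
  have h₂ : c₂ ∣ c₁ * c₂ * c₃ :=
    Dvd.intro (c₁ * c₃) (show c₂ * (c₁ * c₃) = c₁ * c₂ * c₃ by rw [mul_left_comm, mul_assoc])
  have h₃ : c₃ ∣ c₁ * c₂ * c₃ := Dvd.intro (c₁ * c₂) (mul_comm _ _)
  refine ⟨c₁ * c₂ * c₃,
    Level.lift (Level.diag X c₁) (Level.diag X (c₁ * c₂ * c₃)) ⟨h₁, h₁⟩ θ₁,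
    Level.lift (Level.diag X c₂) (Level.diag X (c₁ * c₂ * c₃)) ⟨h₂, h₂⟩ θ₂,
    Level.lift (Level.diag X c₃) (Level.diag X (c₁ * c₂ * c₃)) ⟨h₃, h₃⟩ (End.asHom φ),
    isIso_lift (Level.diag X c₁) (Level.diag X (c₁ * c₂ * c₃)) ⟨h₁, h₁⟩ θ₁ hθ₁,
    isIso_lift (Level.diag X c₂) (Level.diag X (c₁ * c₂ * c₃)) ⟨h₂, h₂⟩ θ₂ hθ₂,
    (endClass_lift_diag X h₁ θ₁).trans e₁, (endClass_lift_diag X h₂ θ₂).trans e₂,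
    (endClass_lift_diag X h₃ (End.asHom φ)).trans e₃, lift_diag_mem X h₃ (End.asHom φ) hφ⟩

end Perfection


end PreFrobenioid

/-! ### Theorem 3.6 (iv), first sentence, for `C^ℚ = C^pf` -/

namespace ArchFrd

namespace Thm36Sub

variable {D : Type u} [Category.{v} D] (π : D ⥤ D0)

open PreFrobenioid PreFrobenioid.Perfection

/-- **[FrdII] Thm. 3.6 (iv), first sentence, for `C^ℚ := C^pf`** (p. 37): for every object `X = (A, n)` of THE
perfection of `C` and automorphisms `α, α'` of `X` with the same image in `Aut_{D₀}(X₀)`, conjugation by `α` and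
by `α'` agree on `O^▷(X)` and on `O^×(X)` — the slot `Thm36Sub.ivFactors_Q` CLOSED, by reduction to the
`Λ = ℤ` theorem `thm36iv_factors_C` at a Frobenius power `A^{(c)}` carrying representatives of `α`, `α'` and of
the element of `O^▷(X)`.  The binder `hF` ("`C` is a Frobenioid", [FrdII] Ex. 3.3 (ii) p. 28) is the
PARAMETER of the construction `C^pf = PreFrobenioid.Perfection hF` carried by the slot `ivFactors_Q π hF`
itself — it is data of the statement, not an assumption on its conclusion (closed form: `∀ π hF, ivFactors_Q π hF`).
[cite: MochizukiFrdII2008, Thm 3.6 (iv) p.37] -/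
theorem ivFactors_Q_holds (hF : PreFrobenioid.IsFrobenioid (C.toElem π)) :
    Literature.AlgebraicGeometry.Frobenioids.ArchFrd.Thm36Sub.ivFactors_Q π hF := by
  intro X α α' hαα'
  have hh := congrArg Iso.hom hαα'
  have key : ∀ f ∈ PreFrobenioid.endSubmonoid (pfStr π hF) X,
      α.inv ≫ f ≫ α.hom = α'.inv ≫ f ≫ α'.hom := by
    intro f hf
    obtain ⟨c, Θ₁, Θ₂, Ψ, i₁, i₂, E₁, E₂, E₃, memΨ⟩ := exists_common_reps X α α' (f := f) hf
    have I₁ : α.inv = endClass X c (inv Θ₁) := inv_eq_endClass_inv X α Θ₁ E₁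
    have I₂ : α'.inv = endClass X c (inv Θ₂) := inv_eq_endClass_inv X α' Θ₂ E₂
    -- the representatives have the same image in `Aut_{D₀}((A^{(c)})₀)`
    have hB : (PreFrobenioid.baseFunctor (C.toElem π) ⋙ (π ⋙ D0.toArchBase)).mapIso (asIso Θ₁) =
        (PreFrobenioid.baseFunctor (C.toElem π) ⋙ (π ⋙ D0.toArchBase)).mapIso (asIso Θ₂) := by
      apply Iso.ext
      rw [Functor.mapIso_hom, Functor.mapIso_hom, ← E₁, ← E₂] at hh
      exact map_base_eq_of_map_endClass_eq X (π ⋙ D0.toArchBase) c Θ₁ Θ₂ hh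
    obtain ⟨keyC, -⟩ := thm36iv_factors_C π (frobPow hF X.obj c) (asIso Θ₁) (asIso Θ₂) hB
    have kc := keyC Ψ memΨ
    simp only [asIso_hom, asIso_inv] at kc
    rw [I₁, I₂, ← E₁, ← E₂, ← E₃]
    simp only [endClass_comp]
    rw [kc]
  refine ⟨key, fun u hu => ?_⟩
  apply Iso.ext
  change α.inv ≫ u.hom ≫ α.hom = α'.inv ≫ u.hom ≫ α'.hom
  exact key u.hom ⟨hu.1, hu.2⟩

end Thm36Sub

end ArchFrd

end Literature.AlgebraicGeometry.Frobenioids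

end
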